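import Summits.CriticalPhenomena.PercolationContinuityZ3.Theorems.PercNearOneGluingNoHeavyLowerTailKNGoodGMgcSideDecomp
import Summits.CriticalPhenomena.PercolationContinuityZ3.Theorems.PercNearOneGluingNoHeavyLowerTailKNGoodGMgcGlueCongr
import HarnessLib

/-!
# Side frame of THEOREM B's gadget `K = C + x + y + z + pairs`: vertices, the twelve side edges, pendant weights, core and glued cores
# (`NoHeavyLowerTail` cell, stmt-CriticalPhenomena-4575; prover `prim-hp-2`, gen 19 — semantic layer of THEOREM B,
# memo `run/shared/lean/prim/prim-hp-2/MEMO-gen17-lean-certificates.md` §4')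

Support file (`--supports stmt-CriticalPhenomena-4575`).  Small computable definitions + bookkeeping lemmas; no named facts, no sorries.
Setting (MEMO-gen15 §3a, `…KNGoodGMgcCert`): core `C` with three relays `a₁,a₂,a₃`, pendant stars `x,y,z` whose hairs go to the
relays only, and the three inner pairs `yz, xz, xy`.
* `force_apply_of_forall_ne`, `force_apply_self` — values of `KNGoodGMgc.force` (`…KNGoodGMgcSideDecomp`).
* `Verts` — the six named vertices `x,y,z,a₁,a₂,a₃` (pairwise distinct); `Verts.emb` places the abstract vertices `0..5`;
  `Verts.e k` = the twelve side edges in the bit order of `…KNGoodGMgcCert`: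
  `e 0..11 = s(x,a₁),s(x,a₂),s(x,a₃),s(y,a₁),s(y,a₂),s(y,a₃),s(z,a₁),s(z,a₂),s(z,a₃),s(y,z),s(x,z),s(x,y)` (pairwise distinct, each meets `{x,y,z}`).
* `Verts.Pendant u` — apart from the side edges every pair at `x,y,z` has weight `0`; `Verts.core u` — `u` with the pairs at `x,y,z`
  killed; `Verts.glued u π` — the core with the pairs of `glueAbs π` made sure (`π ∈ {0,3,5,6,7}` = `d,[12],[13],[23],[123]`).
* `mk12`, `trunc`, `sideWorld_congr` — twelve-bit truncation; `openAbs c` — abstract open side edges at `c`;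
  **`force_side_eq`** — under a pendant `u`, `force u e 12 c = core u` with the open side edges made sure.
The sequel `…KNGoodGMgcSideGlue.lean` proves that this forced side connects the core exactly as `glued u (sideWorld c)`.
-/

namespace Summit.CriticalPhenomena.PercolationContinuityZ3.Theorems

namespace KNGoodGMgc

open MeasureTheory Set Literature.Probability.LatticeModels Literature.Probability.Percolation
open scoped Classical

variable {n : ℕ}

/-! ## Values of `force` -/

/-- A pair that is none of the forced edges keeps its weight. [folklore] -/
theorem force_apply_of_forall_ne (w : Sym2 (Fin n) → unitInterval) (e : ℕ → Sym2 (Fin n)) :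
    ∀ (m : ℕ) (c : Cfg) (f : Sym2 (Fin n)), (∀ k, k < m → e k ≠ f) → force w e m c f = w f
  | 0, _, _, _ => rfl
  | m + 1, c, f, h => by
    simp only [force]
    rw [Function.update_of_ne (h m (Nat.lt_succ_self m)).symm]
    exact force_apply_of_forall_ne w e m c f (fun k hk => h k (Nat.lt_succ_of_lt hk))

/-- A forced edge gets weight `1`/`0` according to its bit (edges pairwise distinct). [folklore] -/
theorem force_apply_self (w : Sym2 (Fin n) → unitInterval) (e : ℕ → Sym2 (Fin n)) :
    ∀ (m : ℕ), (∀ i j, i < m → j < m → i ≠ j → e i ≠ e j) → ∀ (c : Cfg) (k : ℕ), k < m →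
      force w e m c (e k) = if c k then 1 else 0
  | 0, _, _, _, hk => absurd hk (Nat.not_lt_zero _)
  | m + 1, hinj, c, k, hk => by
    simp only [force]
    rcases Nat.lt_succ_iff_lt_or_eq.1 hk with hlt | rfl
    · rw [Function.update_of_ne (hinj k m hk (Nat.lt_succ_self m) (Nat.ne_of_lt hlt))]
      exact force_apply_self w e m (fun i j hi hj hij => hinj i j (Nat.lt_succ_of_lt hi) (Nat.lt_succ_of_lt hj) hij) c k hlt
    · rw [Function.update_self]

/-! ## The vertex frame and the twelve side edges -/

/-- The six named vertices of the gadget: pendant stars `x, y, z` and relays `a₁, a₂, a₃`, pairwise distinct. [this work] -/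
structure Verts (n : ℕ) where
  /-- first star (merged with `y` into the observer `o*`) -/
  x : Fin n
  /-- second star -/
  y : Fin n
  /-- third star (the grandchild) -/
  z : Fin n
  /-- first relay -/
  a₁ : Fin n
  /-- second relay -/
  a₂ : Fin n
  /-- third relay -/
  a₃ : Fin n
  /-- distinctness -/ hxy : x ≠ y
  /-- distinctness -/ hxz : x ≠ z
  /-- distinctness -/ hyz : y ≠ z
  /-- distinctness -/ hxa₁ : x ≠ a₁
  /-- distinctness -/ hxa₂ : x ≠ a₂
  /-- distinctness -/ hxa₃ : x ≠ a₃
  /-- distinctness -/ hya₁ : y ≠ a₁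
  /-- distinctness -/ hya₂ : y ≠ a₂
  /-- distinctness -/ hya₃ : y ≠ a₃
  /-- distinctness -/ hza₁ : z ≠ a₁
  /-- distinctness -/ hza₂ : z ≠ a₂
  /-- distinctness -/ hza₃ : z ≠ a₃
  /-- distinctness -/ h12 : a₁ ≠ a₂
  /-- distinctness -/ h13 : a₁ ≠ a₃
  /-- distinctness -/ h23 : a₂ ≠ a₃

namespace Verts

variable (V : Verts n)

/-- Placement of the abstract vertices `0..5 = x,y,z,a₁,a₂,a₃` (indices `≥ 5` all go to `a₃`). [this work] -/
def emb (i : ℕ) : Fin n :=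
  if i = 0 then V.x else if i = 1 then V.y else if i = 2 then V.z else if i = 3 then V.a₁ else if i = 4 then V.a₂ else V.a₃

/-- `emb 0 = x`. [this work] -/ @[simp] theorem emb_zero : V.emb 0 = V.x := rfl
/-- `emb 1 = y`. [this work] -/ @[simp] theorem emb_one : V.emb 1 = V.y := rfl
/-- `emb 2 = z`. [this work] -/ @[simp] theorem emb_two : V.emb 2 = V.z := rfl
/-- `emb 3 = a₁`. [this work] -/ @[simp] theorem emb_three : V.emb 3 = V.a₁ := rfl
/-- `emb 4 = a₂`. [this work] -/ @[simp] theorem emb_four : V.emb 4 = V.a₂ := rfl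
/-- `emb 5 = a₃`. [this work] -/ @[simp] theorem emb_five : V.emb 5 = V.a₃ := rfl

/-- `emb` is injective on `[0,6)`. [this work] -/
theorem emb_inj : ∀ i j : ℕ, i < 6 → j < 6 → V.emb i = V.emb j → i = j := by
  have := V.hxy; have := V.hxz; have := V.hyz; have := V.hxa₁; have := V.hxa₂; have := V.hxa₃
  have := V.hya₁; have := V.hya₂; have := V.hya₃; have := V.hza₁; have := V.hza₂; have := V.hza₃
  have := V.h12; have := V.h13; have := V.h23
  intro i j hi hj h
  interval_cases i <;> interval_cases j <;> simp_all [emb, eq_comm]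

end Verts

/-- The abstract side edges on the vertices `0..5 = x,y,z,a₁,a₂,a₃`, in the bit order of `…KNGoodGMgcCert`:
`x a₁, x a₂, x a₃, y a₁, y a₂, y a₃, z a₁, z a₂, z a₃, y z, x z, x y`. [this work] -/
def sideAbs : List (ℕ × ℕ) :=
  [(0, 3), (0, 4), (0, 5), (1, 3), (1, 4), (1, 5), (2, 3), (2, 4), (2, 5), (1, 2), (0, 2), (0, 1)]

/-- The `k`-th abstract side edge (junk `(0,0)` from `12` on). [this work] -/
def sideAt (k : ℕ) : ℕ × ℕ := sideAbs.getD k (0, 0)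

/-- The `k`-th side edge of the frame. [this work] -/
def Verts.e (V : Verts n) (k : ℕ) : Sym2 (Fin n) := s(V.emb (sideAt k).1, V.emb (sideAt k).2)

namespace Verts

variable (V : Verts n)

/-- side edge `0` is `x a₁`. [this work] -/ @[simp] theorem e_0 : V.e 0 = s(V.x, V.a₁) := rfl
/-- side edge `1` is `x a₂`. [this work] -/ @[simp] theorem e_1 : V.e 1 = s(V.x, V.a₂) := rfl
/-- side edge `2` is `x a₃`. [this work] -/ @[simp] theorem e_2 : V.e 2 = s(V.x, V.a₃) := rfl
/-- side edge `3` is `y a₁`. [this work] -/ @[simp] theorem e_3 : V.e 3 = s(V.y, V.a₁) := rfl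
/-- side edge `4` is `y a₂`. [this work] -/ @[simp] theorem e_4 : V.e 4 = s(V.y, V.a₂) := rfl
/-- side edge `5` is `y a₃`. [this work] -/ @[simp] theorem e_5 : V.e 5 = s(V.y, V.a₃) := rfl
/-- side edge `6` is `z a₁`. [this work] -/ @[simp] theorem e_6 : V.e 6 = s(V.z, V.a₁) := rfl
/-- side edge `7` is `z a₂`. [this work] -/ @[simp] theorem e_7 : V.e 7 = s(V.z, V.a₂) := rfl
/-- side edge `8` is `z a₃`. [this work] -/ @[simp] theorem e_8 : V.e 8 = s(V.z, V.a₃) := rfl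
/-- side edge `9` is `y z`. [this work] -/ @[simp] theorem e_9 : V.e 9 = s(V.y, V.z) := rfl
/-- side edge `10` is `x z`. [this work] -/ @[simp] theorem e_10 : V.e 10 = s(V.x, V.z) := rfl
/-- side edge `11` is `x y`. [this work] -/ @[simp] theorem e_11 : V.e 11 = s(V.x, V.y) := rfl

end Verts

/-- Abstract facts about the side-edge list: endpoints below `6`, distinct endpoints, pairwise distinct as unordered pairs,
and every edge has an endpoint among `0,1,2`. [this work] -/
theorem sideAbs_facts :
    ((List.range 12).all fun k =>
      decide ((sideAt k).1 < 6) && decide ((sideAt k).2 < 6) && !((sideAt k).1 == (sideAt k).2) &&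
        decide ((sideAt k).1 < 3) &&
        (List.range 12).all fun l => (k == l) ||
          !(((sideAt k).1 == (sideAt l).1 && (sideAt k).2 == (sideAt l).2) ||
            ((sideAt k).1 == (sideAt l).2 && (sideAt k).2 == (sideAt l).1))) = true := by decide

/-- Endpoints of an abstract side edge. [this work] -/
theorem sideAt_lt (k : ℕ) (hk : k < 12) : (sideAt k).1 < 6 ∧ (sideAt k).2 < 6 ∧ (sideAt k).1 ≠ (sideAt k).2 ∧ (sideAt k).1 < 3 := by
  have h := List.all_eq_true.1 sideAbs_facts k (List.mem_range.2 hk)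
  simp only [Bool.and_eq_true, decide_eq_true_eq, Bool.not_eq_true', beq_eq_false_iff_ne, ne_eq] at h
  exact ⟨h.1.1.1.1, h.1.1.1.2, h.1.1.2, h.1.2⟩

/-- Two different abstract side edges are different unordered pairs. [this work] -/
theorem sideAt_ne (k l : ℕ) (hk : k < 12) (hl : l < 12) (hkl : k ≠ l) :
    ¬(((sideAt k).1 = (sideAt l).1 ∧ (sideAt k).2 = (sideAt l).2) ∨ ((sideAt k).1 = (sideAt l).2 ∧ (sideAt k).2 = (sideAt l).1)) := by
  have h := List.all_eq_true.1 sideAbs_facts k (List.mem_range.2 hk)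
  simp only [Bool.and_eq_true] at h
  have h' := List.all_eq_true.1 h.2 l (List.mem_range.2 hl)
  simp only [Bool.or_eq_true, beq_iff_eq, Bool.not_eq_true', Bool.or_eq_false_iff, Bool.and_eq_false_iff,
    beq_eq_false_iff_ne, ne_eq] at h'
  rcases h' with h' | ⟨h1, h2⟩
  · exact absurd h' hkl
  · rintro (⟨ha, hb⟩ | ⟨ha, hb⟩)
    · rcases h1 with h1 | h1
      · exact h1 ha
      · exact h1 hb
    · rcases h2 with h2 | h2
      · exact h2 ha
      · exact h2 hb

namespace Verts

variable (V : Verts n)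

/-- The twelve side edges are pairwise distinct. [this work] -/
theorem e_inj : ∀ i j : ℕ, i < 12 → j < 12 → i ≠ j → V.e i ≠ V.e j := by
  intro i j hi hj hij h
  obtain ⟨hi1, hi2, -, -⟩ := sideAt_lt i hi
  obtain ⟨hj1, hj2, -, -⟩ := sideAt_lt j hj
  apply sideAt_ne i j hi hj hij
  rcases Sym2.eq_iff.1 h with ⟨ha, hb⟩ | ⟨ha, hb⟩
  · exact Or.inl ⟨V.emb_inj _ _ hi1 hj1 ha, V.emb_inj _ _ hi2 hj2 hb⟩
  · exact Or.inr ⟨V.emb_inj _ _ hi1 hj2 ha, V.emb_inj _ _ hi2 hj1 hb⟩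

/-- Every side edge has an endpoint in `{x, y, z}`. [this work] -/
theorem e_touches (k : ℕ) (hk : k < 12) : V.x ∈ V.e k ∨ V.y ∈ V.e k ∨ V.z ∈ V.e k := by
  obtain ⟨-, -, -, h3⟩ := sideAt_lt k hk
  unfold Verts.e
  generalize (sideAt k).1 = i at h3
  interval_cases i
  · exact Or.inl (Sym2.mem_mk_left _ _)
  · exact Or.inr (Or.inl (Sym2.mem_mk_left _ _))
  · exact Or.inr (Or.inr (Sym2.mem_mk_left _ _))

/-- The side edges are not loops. [this work] -/
theorem e_not_isDiag (k : ℕ) (hk : k < 12) : ¬(V.e k).IsDiag := by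
  obtain ⟨h1, h2, hne, -⟩ := sideAt_lt k hk
  unfold Verts.e
  rw [Sym2.mk_isDiag_iff]
  exact fun h => hne (V.emb_inj _ _ h1 h2 h)

/-! ## Pendant hypothesis, core, glued cores -/

/-- The side is PENDANT for the weights `u`: apart from the twelve side edges, every pair at `x`, `y` or `z` (loops included)
has weight `0` (three pendant stars with the three inner pairs). [folklore] -/
structure Pendant (u : Sym2 (Fin n) → unitInterval) : Prop where
  /-- `x` is joined only to the relays, `y` and `z` -/
  hx : ∀ t : Fin n, t ≠ V.a₁ → t ≠ V.a₂ → t ≠ V.a₃ → t ≠ V.y → t ≠ V.z → u s(V.x, t) = 0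
  /-- `y` is joined only to the relays, `x` and `z` -/
  hy : ∀ t : Fin n, t ≠ V.a₁ → t ≠ V.a₂ → t ≠ V.a₃ → t ≠ V.x → t ≠ V.z → u s(V.y, t) = 0
  /-- `z` is joined only to the relays, `x` and `y` -/
  hz : ∀ t : Fin n, t ≠ V.a₁ → t ≠ V.a₂ → t ≠ V.a₃ → t ≠ V.x → t ≠ V.y → u s(V.z, t) = 0

/-- The core: `u` with every pair at `x`, `y`, `z` killed. [this work] -/
def core (u : Sym2 (Fin n) → unitInterval) : Sym2 (Fin n) → unitInterval :=
  fun f => if V.x ∈ f then 0 else if V.y ∈ f then 0 else if V.z ∈ f then 0 else u f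

/-- The core vanishes at the vertices `x, y, z`. [this work] -/
theorem core_eq_zero (u : Sym2 (Fin n) → unitInterval) (f : Sym2 (Fin n))
    (hf : ∃ v ∈ ({V.x, V.y, V.z} : Finset (Fin n)), v ∈ f) : V.core u f = 0 := by
  obtain ⟨v, hv, hvf⟩ := hf
  simp only [Finset.mem_insert, Finset.mem_singleton] at hv
  unfold core
  rcases hv with rfl | rfl | rfl <;> simp only [hvf, if_true] <;> split_ifs <;> rfl

/-- Off `x, y, z` the core is `u`. [this work] -/
theorem core_eq_self (u : Sym2 (Fin n) → unitInterval) (f : Sym2 (Fin n)) (hx : V.x ∉ f) (hy : V.y ∉ f) (hz : V.z ∉ f) :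
    V.core u f = u f := by
  simp [core, hx, hy, hz]

/-- A pair at `x`, `y` or `z` that is not a side edge has weight `0` under a pendant `u`. [this work] -/
theorem pendant_zero {u : Sym2 (Fin n) → unitInterval} (hP : V.Pendant u) (f : Sym2 (Fin n))
    (hf : V.x ∈ f ∨ V.y ∈ f ∨ V.z ∈ f) (hne : ∀ k, k < 12 → V.e k ≠ f) : u f = 0 := by
  obtain ⟨hxN, hyN, hzN⟩ := hP
  have key : ∀ (v : Fin n), v ∈ f → (v = V.x ∨ v = V.y ∨ v = V.z) → u f = 0 := by
    intro v hv hv3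
    obtain ⟨t, rfl⟩ : ∃ t, f = s(v, t) := by
      induction f using Sym2.ind with
      | h p q =>
        rcases Sym2.mem_iff.1 hv with rfl | rfl
        · exact ⟨q, rfl⟩
        · exact ⟨p, Sym2.eq_swap⟩
    rcases hv3 with rfl | rfl | rfl
    · refine hxN t ?_ ?_ ?_ ?_ ?_ <;> rintro rfl
      · exact hne 0 (by norm_num) (by simp)
      · exact hne 1 (by norm_num) (by simp)
      · exact hne 2 (by norm_num) (by simp)
      · exact hne 11 (by norm_num) (by simp)
      · exact hne 10 (by norm_num) (by simp)
    · refine hyN t ?_ ?_ ?_ ?_ ?_ <;> rintro rfl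
      · exact hne 3 (by norm_num) (by simp)
      · exact hne 4 (by norm_num) (by simp)
      · exact hne 5 (by norm_num) (by simp)
      · exact hne 11 (by norm_num) (by simp [Sym2.eq_swap])
      · exact hne 9 (by norm_num) (by simp)
    · refine hzN t ?_ ?_ ?_ ?_ ?_ <;> rintro rfl
      · exact hne 6 (by norm_num) (by simp)
      · exact hne 7 (by norm_num) (by simp)
      · exact hne 8 (by norm_num) (by simp)
      · exact hne 10 (by norm_num) (by simp [Sym2.eq_swap])
      · exact hne 9 (by norm_num) (by simp [Sym2.eq_swap])
  rcases hf with h | h | h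
  · exact key _ h (Or.inl rfl)
  · exact key _ h (Or.inr (Or.inl rfl))
  · exact key _ h (Or.inr (Or.inr rfl))

end Verts


/-! ## Twelve-bit configurations -/

/-- The configuration with the given twelve bits (bits `≥ 12` false). [this work] -/
def mk12 (b0 b1 b2 b3 b4 b5 b6 b7 b8 b9 b10 b11 : Bool) : Cfg := fun k =>
  match k with
  | 0 => b0 | 1 => b1 | 2 => b2 | 3 => b3 | 4 => b4 | 5 => b5 | 6 => b6 | 7 => b7 | 8 => b8 | 9 => b9 | 10 => b10
  | 11 => b11 | _ => false

/-- The twelve-bit truncation of a configuration. [this work] -/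
def trunc (c : Cfg) : Cfg := mk12 (c 0) (c 1) (c 2) (c 3) (c 4) (c 5) (c 6) (c 7) (c 8) (c 9) (c 10) (c 11)

/-- `trunc c` agrees with `c` below `12`. [this work] -/
theorem trunc_apply (c : Cfg) (k : ℕ) (hk : k < 12) : trunc c k = c k := by
  unfold trunc
  interval_cases k <;> rfl

/-- `sideWorld` reads only the bits below `12`. [this work] -/
theorem sideWorld_congr (c c' : Cfg) (h : ∀ k, k < 12 → c k = c' k) : sideWorld c = sideWorld c' := by
  simp only [sideWorld, hitX, hitY, hitZ, h 0 (by norm_num), h 1 (by norm_num), h 2 (by norm_num), h 3 (by norm_num),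
    h 4 (by norm_num), h 5 (by norm_num), h 6 (by norm_num), h 7 (by norm_num), h 8 (by norm_num), h 9 (by norm_num),
    h 10 (by norm_num), h 11 (by norm_num)]

/-- `sideWorld c = sideWorld (trunc c)`. [this work] -/
theorem sideWorld_trunc (c : Cfg) : sideWorld c = sideWorld (trunc c) :=
  sideWorld_congr c (trunc c) fun k hk => (trunc_apply c k hk).symm

/-! ## Open side edges and glue sets -/

/-- The abstract side edges that are open (bit `true`) at the configuration `c`. [this work] -/
def openAbs (c : Cfg) : List (ℕ × ℕ) := ((List.range 12).filter fun k => c k).map sideAt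

/-- `openAbs` reads only the bits below `12`. [this work] -/
theorem openAbs_congr (c c' : Cfg) (h : ∀ k, k < 12 → c k = c' k) : openAbs c = openAbs c' := by
  unfold openAbs
  congr 1
  exact List.filter_congr fun k hk => by rw [h k (List.mem_range.1 hk)]

namespace Verts

variable (V : Verts n)

/-- Membership in the placed open side edges. [this work] -/
theorem mem_cimg_openAbs (c : Cfg) (f : Sym2 (Fin n)) :
    f ∈ cimg V.emb (openAbs c) ↔ ∃ k, k < 12 ∧ c k = true ∧ V.e k = f := by
  rw [mem_cimg]
  simp only [openAbs, List.mem_map, List.mem_filter, List.mem_range]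
  constructor
  · rintro ⟨e, ⟨k, ⟨hk, hck⟩, rfl⟩, he⟩
    exact ⟨k, hk, hck, he⟩
  · rintro ⟨k, hk, hck, he⟩
    exact ⟨sideAt k, ⟨k, ⟨hk, hck⟩, rfl⟩, he⟩

/-- **Forcing the side.**  Under a pendant `u`, forcing the twelve side edges according to `c` gives the core with the open
side edges made sure. [this work] -/
theorem force_side_eq {u : Sym2 (Fin n) → unitInterval} (hP : V.Pendant u) (c : Cfg) :
    force u V.e 12 c = fun f => if f ∈ cimg V.emb (openAbs c) then 1 else V.core u f := by
  funext f
  by_cases hf : ∃ k, k < 12 ∧ V.e k = f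
  · obtain ⟨k, hk, rfl⟩ := hf
    rw [force_apply_self u V.e 12 V.e_inj c k hk]
    by_cases hck : c k = true
    · have hmem : V.e k ∈ cimg V.emb (openAbs c) := (V.mem_cimg_openAbs c _).2 ⟨k, hk, hck, rfl⟩
      rw [if_pos hck, if_pos hmem]
    · have hnm : V.e k ∉ cimg V.emb (openAbs c) := by
        intro h
        obtain ⟨l, hl, hcl, hle⟩ := (V.mem_cimg_openAbs c _).1 h
        have hlk : l ≠ k := fun hlk => hck (hlk ▸ hcl)
        exact V.e_inj l k hl hk hlk hle
      rw [if_neg hck, if_neg hnm, V.core_eq_zero u (V.e k)]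
      rcases V.e_touches k hk with h | h | h
      · exact ⟨V.x, by simp, h⟩
      · exact ⟨V.y, by simp, h⟩
      · exact ⟨V.z, by simp, h⟩
  · push Not at hf
    rw [force_apply_of_forall_ne u V.e 12 c f (fun k hk => hf k hk)]
    have hnm : f ∉ cimg V.emb (openAbs c) := by
      intro h
      obtain ⟨l, hl, -, hle⟩ := (V.mem_cimg_openAbs c _).1 h
      exact hf l hl hle
    rw [if_neg hnm]
    by_cases ht : V.x ∈ f ∨ V.y ∈ f ∨ V.z ∈ f
    · rw [V.pendant_zero hP f ht (fun k hk => hf k hk), V.core_eq_zero u f]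
      rcases ht with h | h | h
      · exact ⟨V.x, by simp, h⟩
      · exact ⟨V.y, by simp, h⟩
      · exact ⟨V.z, by simp, h⟩
    · push Not at ht
      rw [V.core_eq_self u f ht.1 ht.2.1 ht.2.2]

end Verts

/-- The abstract glue set of a world (masks `3 = [12], 5 = [13], 6 = [23], 7 = [123]`; anything else, in particular `0 = d`,
glues nothing). [this work] -/
def glueAbs (π : ℕ) : List (ℕ × ℕ) :=
  if π = 3 then [(3, 4)] else if π = 5 then [(3, 5)] else if π = 6 then [(4, 5)] else if π = 7 then [(3, 4), (3, 5)] else []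

namespace Verts

variable (V : Verts n)

/-- The glued core of the world `π`: `core u` with the pairs of `glueAbs π` made sure. [this work] -/
def glued (u : Sym2 (Fin n) → unitInterval) (π : ℕ) : Sym2 (Fin n) → unitInterval :=
  fun f => if f ∈ cimg V.emb (glueAbs π) then 1 else V.core u f

/-- Glue set of the discrete world. [this work] -/
@[simp] theorem cimg_glueAbs_zero : cimg V.emb (glueAbs 0) = ∅ := by simp [cimg, glueAbs]
/-- Glue set of `[12]`. [this work] -/
@[simp] theorem cimg_glueAbs_three : cimg V.emb (glueAbs 3) = {s(V.a₁, V.a₂)} := by simp [cimg, glueAbs]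
/-- Glue set of `[13]`. [this work] -/
@[simp] theorem cimg_glueAbs_five : cimg V.emb (glueAbs 5) = {s(V.a₁, V.a₃)} := by simp [cimg, glueAbs]
/-- Glue set of `[23]`. [this work] -/
@[simp] theorem cimg_glueAbs_six : cimg V.emb (glueAbs 6) = {s(V.a₂, V.a₃)} := by simp [cimg, glueAbs]
/-- Glue set of `[123]`. [this work] -/
@[simp] theorem cimg_glueAbs_seven : cimg V.emb (glueAbs 7) = {s(V.a₁, V.a₂), s(V.a₁, V.a₃)} := by simp [cimg, glueAbs]

/-- The discrete world glues nothing: `glued u 0 = core u`. [this work] -/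
theorem glued_zero (u : Sym2 (Fin n) → unitInterval) : V.glued u 0 = V.core u := by
  funext f; simp [glued]

end Verts

end KNGoodGMgc

end Summit.CriticalPhenomena.PercolationContinuityZ3.Theorems
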